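import Literature.Barriers.CriticalPhenomena.PlaquetteWalkHoleRootWoundCostNS
import HarnessLib

/-!
# Barrier catalogue (SAWScalingLimit): the LEFTMOST COLUMN of a wound walk from a hole root — west of the hole, no `W` sides, singly
visited, entered and left by turns («EXTREME COLUMNS»)

The column twin of `PlaquetteWalkHoleRootExtremeRows` §§3–5 (topmost row: `forall_top_ne_N`, `top_single_visit`, entry/exit corners), for the
«RECTANGLE COEFFICIENT» classification (DESIGN-next b-engine-1 g24 §2bis (R2): the extreme columns of a cost-`5` wound member).

* `YBWalk.fc_pred_eq_of_sIn_W` / `…_E` (an arc entered through `W`/`E` is preceded by the arc in the west/east neighbour);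
  `YBWalk.exists_side_of_fc_eq` (two different arcs in one plaquette use all four sides), `YBWalk.eq_of_fc_eq_of_forall_ne_side`.
* ★ `ΩG.exists_fc_west_of_wound`: a wound class-`B2a` walk from the hole root `w.side W` (hole `(w.1 − 1, w.2)` absent) has an arc in a
  column `≤ w.1 − 2`, i.e. strictly WEST of the hole column (the excursion crosses the westward ray behind the root at a slanted edge
  `slant (w.1 − 1 − m) w.2` with `m ≥ 1` — `m = 0` would put an arc in the hole).
* ★ `ΩG.forall_left_ne_W`: no arc of the leftmost column uses a `W` side (the predecessor/successor would lie further west; the last arc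
  leaving `W` would return to an `r` further west or re-enter `r`); ★ `ΩG.left_single_visit`: the leftmost column is singly visited.
* ★★ `ΩG.exists_left_entry_turn` / `ΩG.left_exit_or_end`: the first arc in the leftmost column enters from `E` and turns (`E → N/S`); the
  last arc there leaves through `E` after a vertical entry (a turn) or is the walk's last arc (then `r` lies in that column and the end
  side is slanted); ★★ `ΩG.two_left_turns`: two isolated turns in the leftmost column, or one and a slanted end there.

[GlazmanManolescu2019 §1 Fig. 1, Lemma 2.1; Glazman 2015 Lemma 3.1 (proof, pp. 6–7); Courant–Robbins, even–odd rule]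
-/

noncomputable section

namespace Literature.Probability.RandomPlanarGeometry.SAW.YangBaxter

open Real
open Literature.Barriers.CriticalPhenomena.PlaquetteWalk

open private fc_fh fc_ne fh_add_Mv three_le_Mv from Literature.Probability.RandomPlanarGeometry.YangBaxterSAWGeneralDomain

namespace YBWalk

variable {D : Set Face} {a z : MidEdge} (γ : YBWalk D a z)

/-- An arc entering through `W` is preceded by an arc in the WEST neighbour (which left through its `E` side). [cite: GlazmanManolescu2019, §1, Fig. 1] -/
theorem fc_pred_eq_of_sIn_W {i : ℕ} (hi : i < γ.arcs.length) (h1 : 1 ≤ i) (hW : γ.sIn i = .W) :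
    γ.fc (i - 1) = ((γ.fc i).1 - 1, (γ.fc i).2) ∧ γ.sOut (i - 1) = .E := by
  obtain ⟨hin, -⟩ := γ.side_sIn_eq_nth hi
  have hi' : i - 1 + 1 < γ.arcs.length := by omega
  obtain ⟨-, hout⟩ := γ.side_sIn_eq_nth (show i - 1 < γ.arcs.length by omega)
  rw [show i - 1 + 1 = i by omega] at hout
  rw [hW] at hin
  have e : (γ.fc (i - 1)).side (γ.sOut (i - 1)) = .vert (γ.fc i).1 (γ.fc i).2 := by
    rw [hout, ← hin]; obtain ⟨k, j⟩ := γ.fc i; rfl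
  rcases eq_of_side_eq_vert e with ⟨h2, hs⟩ | ⟨h2, hs⟩
  · exfalso; refine γ.fc_succ_ne hi' ?_
    rw [show i - 1 + 1 = i by omega, h2]
  · exact ⟨h2, hs⟩

/-- An arc entering through `E` is preceded by an arc in the EAST neighbour (which left through its `W` side). [cite: GlazmanManolescu2019, §1, Fig. 1] -/
theorem fc_pred_eq_of_sIn_E {i : ℕ} (hi : i < γ.arcs.length) (h1 : 1 ≤ i) (hE : γ.sIn i = .E) :
    γ.fc (i - 1) = ((γ.fc i).1 + 1, (γ.fc i).2) ∧ γ.sOut (i - 1) = .W := by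
  obtain ⟨hin, -⟩ := γ.side_sIn_eq_nth hi
  have hi' : i - 1 + 1 < γ.arcs.length := by omega
  obtain ⟨-, hout⟩ := γ.side_sIn_eq_nth (show i - 1 < γ.arcs.length by omega)
  rw [show i - 1 + 1 = i by omega] at hout
  rw [hE] at hin
  have e : (γ.fc (i - 1)).side (γ.sOut (i - 1)) = .vert ((γ.fc i).1 + 1) (γ.fc i).2 := by
    rw [hout, ← hin]; obtain ⟨k, j⟩ := γ.fc i; rfl
  rcases eq_of_side_eq_vert e with ⟨h2, hs⟩ | ⟨h2, hs⟩
  · exact ⟨h2, hs⟩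
  · exfalso; refine γ.fc_succ_ne hi' ?_
    rw [show i - 1 + 1 = i by omega, h2]; obtain ⟨k, j⟩ := γ.fc i; simp

/-- Two different arcs `i < j` in one plaquette use all four sides. [cite: GlazmanManolescu2019, §1, Fig. 1] -/
private theorem exists_side_of_fc_eq_lt {i j : ℕ} (hi : i < γ.arcs.length) (hj : j < γ.arcs.length) (hlt : i < j)
    (he : γ.fc i = γ.fc j) (s : Side) : γ.sIn i = s ∨ γ.sOut i = s ∨ γ.sIn j = s ∨ γ.sOut j = s := by
  obtain ⟨hin_i, hout_i⟩ := γ.side_sIn_eq_nth hi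
  obtain ⟨hin_j, hout_j⟩ := γ.side_sIn_eq_nth hj
  rw [← he] at hin_j hout_j
  have hsi := γ.sIn_ne_sOut hi
  have hsj : γ.sIn j ≠ γ.sOut j := γ.sIn_ne_sOut hj
  have d1 : γ.sIn i ≠ γ.sIn j := fun e => by
    have := γ.nth_inj (show i ≤ γ.arcs.length by omega) (show j ≤ γ.arcs.length by omega)
      (hin_i.symm.trans (by rw [e]; exact hin_j)); omega
  have d2 : γ.sIn i ≠ γ.sOut j := fun e => by
    have := γ.nth_inj (show i ≤ γ.arcs.length by omega) (show j + 1 ≤ γ.arcs.length by omega)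
      (hin_i.symm.trans (by rw [e]; exact hout_j)); omega
  have d3 : γ.sOut i ≠ γ.sIn j := fun e => by
    have hj1 : j ≠ i + 1 := by rintro rfl; exact γ.fc_succ_ne hj he
    have := γ.nth_inj (show i + 1 ≤ γ.arcs.length by omega) (show j ≤ γ.arcs.length by omega)
      (hout_i.symm.trans (by rw [e]; exact hin_j)); omega
  have d4 : γ.sOut i ≠ γ.sOut j := fun e => by
    have := γ.nth_inj (show i + 1 ≤ γ.arcs.length by omega) (show j + 1 ≤ γ.arcs.length by omega)
      (hout_i.symm.trans (by rw [e]; exact hout_j)); omega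
  revert hsi hsj d1 d2 d3 d4
  cases γ.sIn i <;> cases γ.sOut i <;> cases γ.sIn j <;> cases γ.sOut j <;> cases s <;> simp

/-- **Two different arcs in the same plaquette use all four sides**: every side is the entry or exit side of one of them.
[cite: GlazmanManolescu2019, §1, Fig. 1 (two arcs in a rhombus: the two corner configurations `w₁`, `w₂`)] -/
theorem exists_side_of_fc_eq {i j : ℕ} (hi : i < γ.arcs.length) (hj : j < γ.arcs.length) (hij : i ≠ j) (he : γ.fc i = γ.fc j)
    (s : Side) : γ.sIn i = s ∨ γ.sOut i = s ∨ γ.sIn j = s ∨ γ.sOut j = s := by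
  rcases Nat.lt_or_gt_of_ne hij with hlt | hgt
  · exact γ.exists_side_of_fc_eq_lt hi hj hlt he s
  · have := γ.exists_side_of_fc_eq_lt hj hi hgt he.symm s
    tauto

/-- If no arc of a set of plaquettes (here: a column) uses the side `s`, its plaquettes are singly visited.
[cite: GlazmanManolescu2019, §1, Fig. 1] -/
theorem eq_of_fc_eq_of_forall_ne_side (s : Side) {X : ℤ}
    (hs : ∀ k < γ.arcs.length, (γ.fc k).1 = X → γ.sIn k ≠ s ∧ γ.sOut k ≠ s)
    {i j : ℕ} (hi : i < γ.arcs.length) (hj : j < γ.arcs.length) (hcol : (γ.fc i).1 = X) (he : γ.fc i = γ.fc j) : i = j := by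
  by_contra hij
  obtain ⟨h1, h2⟩ := hs i hi hcol
  obtain ⟨h3, h4⟩ := hs j hj (by rw [← he]; exact hcol)
  rcases γ.exists_side_of_fc_eq hi hj hij he s with e | e | e | e
  · exact h1 e
  · exact h2 e
  · exact h3 e
  · exact h4 e

end YBWalk

namespace ΩG

variable {D : Set Face} {w r : Face} {ω : ΩG D (w.side .W) r}

/-- ★ **A WOUND WALK GOES WEST OF THE HOLE**: a wound class-`B2a` walk from the hole root `w.side W` (hole `(w.1 − 1, w.2)` absent) has an
arc in the hole row in a column `≤ w.1 − 2` — the excursion crosses the westward ray behind the root at a slanted edge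
`slant (w.1 − 1 − m) w.2`, and `m ≥ 1` since the hole carries no arc. [cite: GlazmanManolescu2019, Lemma 2.1 (statement, "in the form given in [Gl]")]
[cite: CourantRobbins1958, Ch. V Appendix §2 (the even–odd rule)] -/
theorem exists_fc_west_of_wound (hh : holeFaceW w ∉ D) (hr : RootedFace D (w.side .W) r) (h : ω.IsB2a)
    (hA : ω.AJ hr h (toC (midPt (w.side .W))) ≠ 0) :
    ∃ i < ω.2.arcs.length, (ω.2.fc i).2 = w.2 ∧ (ω.2.fc i).1 ≤ w.1 - 2 := by
  have hodd := (ω.AJ_root_ne_zero_iff_odd_rayCountAt (hr := hr) h (b := w) (τ := .W) rfl).1 hA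
  obtain ⟨j, hj, m, he⟩ := ω.exists_exit_eq_rayMid_of_odd hr h hodd
  rw [rayMid_W_eq] at he
  obtain ⟨-, ⟨i, hi, hf⟩⟩ := ω.exists_fc_row_of_exit_slant hr h hj he
  -- `m = 0` would put the arc `i` in the hole
  have hm : 1 ≤ m := by
    by_contra hlt
    have e0 : m = 0 := by omega
    have hD := (YBWalk.arcFace_arcAt hi).2
    rw [hf, e0] at hD
    refine hh ?_
    have : holeFaceW w = (w.1 - 1 - ((0 : ℕ) : ℤ), w.2) := by simp [holeFaceW]
    rw [this]; exact hD
  exact ⟨i, hi, by rw [hf], by rw [hf]; show w.1 - 1 - (m : ℤ) ≤ w.1 - 2; omega⟩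

/-- ★ **NO ARC OF THE LEFTMOST COLUMN USES A `W` SIDE** (`X` the minimal column, which lies west of `w` for a wound walk): the first arc
enters `w` through `W` but `w` is not in the leftmost column; any other `W`-entry or `W`-exit has a neighbour further west; a final
`W`-exit would return to `r` one column further west or re-enter `r`. [cite: GlazmanManolescu2019, §1, Fig. 1; Lemma 2.1]
[cite: Glazman2015WeightedSAW, Lemma 3.1 (proof, pp. 6–7)] -/
theorem forall_left_ne_W (hh : holeFaceW w ∉ D) (hr : RootedFace D (w.side .W) r) (h : ω.IsB2a) {X : ℤ}
    (hX : ∀ j < ω.2.arcs.length, X ≤ (ω.2.fc j).1) (hXw : X < w.1) :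
    ∀ k < ω.2.arcs.length, (ω.2.fc k).1 = X → ω.2.sIn k ≠ .W ∧ ω.2.sOut k ≠ .W := by
  intro k hk hcol
  have hlen : 0 < ω.2.arcs.length := by omega
  have h0 : ω.2.fc 0 = w := fc_zero_eq_root w hh ω.2 hlen
  have hk1 : 1 ≤ k := by
    by_contra hlt
    have e0 : k = 0 := by omega
    rw [e0, h0] at hcol; omega
  constructor
  · intro hW
    obtain ⟨hp, -⟩ := ω.2.fc_pred_eq_of_sIn_W hk hk1 hW
    have := hX (k - 1) (by omega); rw [hp] at this; simp only at this; omega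
  · intro hW
    by_cases hlast : k + 1 < ω.2.arcs.length
    · obtain ⟨hs, -⟩ := ω.2.fc_succ_eq_of_sOut_W hlast hW
      have := hX (k + 1) hlast; rw [hs] at this; simp only at this; omega
    · have hlen1 : k + 1 = ω.2.arcs.length := by omega
      obtain ⟨-, hout⟩ := ω.2.side_sIn_eq_nth hk
      rw [hlen1, ω.2.nth_length, hW] at hout
      have hF : ω.2.firstHitG < k := by
        by_contra hge
        have := three_le_Mv hr h; have := fh_add_Mv h; unfold ΩG.Mv at *; omega
      have hlastne : ω.2.fc k ≠ r := fc_ne ω hr h hF hk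
      have hrcol : X ≤ r.2 * 0 + r.1 := by
        have e := (fc_fh ω hr h).1
        have := hX ω.2.firstHitG (ω.fh_lt h); rw [e] at this; omega
      rcases hfc : ω.2.fc k with ⟨x, y⟩
      rw [hfc] at hcol hout hlastne
      simp only at hcol
      have e : r.side ω.1 = .vert x y := by rw [← hout]; rfl
      rcases eq_of_side_eq_vert e with ⟨h2, -⟩ | ⟨h2, -⟩
      · exact hlastne h2.symm
      · have := congrArg Prod.fst h2; simp only at this; omega

/-- ★ **THE LEFTMOST COLUMN OF A WOUND CLASS-`B2a` WALK IS SINGLY VISITED.** [cite: GlazmanManolescu2019, §1, Fig. 1; Lemma 2.1] -/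
theorem left_single_visit (hh : holeFaceW w ∉ D) (hr : RootedFace D (w.side .W) r) (h : ω.IsB2a) {X : ℤ}
    (hX : ∀ j < ω.2.arcs.length, X ≤ (ω.2.fc j).1) (hXw : X < w.1) {i j : ℕ} (hi : i < ω.2.arcs.length)
    (hj : j < ω.2.arcs.length) (hcol : (ω.2.fc i).1 = X) (he : ω.2.fc i = ω.2.fc j) : i = j :=
  ω.2.eq_of_fc_eq_of_forall_ne_side .W (forall_left_ne_W hh hr h hX hXw) hi hj hcol he

/-- The columns of the arcs, as a finite set; non-empty for a non-trivial walk. [folklore] -/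
private theorem cols_nonempty (hlen : 0 < ω.2.arcs.length) :
    ((Finset.range ω.2.arcs.length).image fun i => (ω.2.fc i).1).Nonempty :=
  ⟨(ω.2.fc 0).1, Finset.mem_image.2 ⟨0, Finset.mem_range.2 hlen, rfl⟩⟩

/-- ★★ **AN ENTRY TURN IN THE LEFTMOST COLUMN**: a wound class-`B2a` walk from the hole root has a LEFTMOST column `X ≤ w.1 − 2`, and the
first arc lying in it (index `≥ 1`) enters from `E` and leaves VERTICALLY — an isolated turn `E → N` or `E → S` in a singly visited
plaquette. [cite: GlazmanManolescu2019, Lemma 2.1; §1, Fig. 1] [cite: CourantRobbins1958, Ch. V Appendix §2 (the even–odd rule)] -/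
theorem exists_left_entry_turn (hh : holeFaceW w ∉ D) (hr : RootedFace D (w.side .W) r) (h : ω.IsB2a)
    (hA : ω.AJ hr h (toC (midPt (w.side .W))) ≠ 0) :
    ∃ X : ℤ, X ≤ w.1 - 2 ∧ (∀ j < ω.2.arcs.length, X ≤ (ω.2.fc j).1) ∧
      ∃ i, 1 ≤ i ∧ i < ω.2.arcs.length ∧ (ω.2.fc i).1 = X ∧ (∀ j < i, (ω.2.fc j).1 ≠ X) ∧
        ω.2.sIn i = .E ∧ (ω.2.sOut i = .N ∨ ω.2.sOut i = .S) := by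
  classical
  have hlen : 0 < ω.2.arcs.length := by have := ω.fh_lt h; omega
  set S := (Finset.range ω.2.arcs.length).image fun i => (ω.2.fc i).1 with hS
  have hne : S.Nonempty := cols_nonempty hlen
  set X := S.min' hne with hXdef
  have hX : ∀ j < ω.2.arcs.length, X ≤ (ω.2.fc j).1 := fun j hj => by
    rw [hXdef]; exact Finset.min'_le S _ (by rw [hS]; exact Finset.mem_image.2 ⟨j, Finset.mem_range.2 hj, rfl⟩)
  obtain ⟨i₁, hi₁, -, hcol₁⟩ := exists_fc_west_of_wound hh hr h hA
  have hXw : X ≤ w.1 - 2 := (hX i₁ hi₁).trans hcol₁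
  have hex : ∃ i, i < ω.2.arcs.length ∧ (ω.2.fc i).1 = X := by
    obtain ⟨i, hi, e⟩ := Finset.mem_image.1 (Finset.min'_mem S hne)
    exact ⟨i, Finset.mem_range.1 hi, e⟩
  let i₀ := Nat.find hex
  obtain ⟨hi₀, hcol₀⟩ : i₀ < ω.2.arcs.length ∧ (ω.2.fc i₀).1 = X := Nat.find_spec hex
  have hmin : ∀ j < i₀, ¬(j < ω.2.arcs.length ∧ (ω.2.fc j).1 = X) := fun j hj => Nat.find_min hex hj
  have h0 : ω.2.fc 0 = w := fc_zero_eq_root w hh ω.2 hlen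
  have hi₀1 : 1 ≤ i₀ := by
    by_contra hlt
    have e0 : i₀ = 0 := by omega
    have := hcol₀; rw [e0, h0] at this; omega
  have hne' := forall_left_ne_W hh hr h hX (by omega)
  have hprev : (ω.2.fc (i₀ - 1)).1 ≠ X := fun e => hmin (i₀ - 1) (by omega) ⟨by omega, e⟩
  -- the entry is `E`: not `W` (leftmost), not vertical (the predecessor would lie in the same column)
  have hE : ω.2.sIn i₀ = .E := by
    cases hs : ω.2.sIn i₀
    · exact absurd hs (hne' i₀ hi₀ hcol₀).1
    · rfl
    · exfalso; apply hprev; rw [ω.2.fc_pred_eq_of_sIn_S hi₀ hi₀1 hs]; exact hcol₀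
    · exfalso; apply hprev; rw [ω.2.fc_pred_eq_of_sIn_N hi₀ hi₀1 hs]; exact hcol₀
  have hsd := ω.2.sIn_ne_sOut hi₀
  rw [hE] at hsd
  have hNS : ω.2.sOut i₀ = .N ∨ ω.2.sOut i₀ = .S := by
    cases hs : ω.2.sOut i₀
    · exact absurd hs (hne' i₀ hi₀ hcol₀).2
    · exact absurd hs.symm hsd
    · exact Or.inr rfl
    · exact Or.inl rfl
  exact ⟨X, hXw, hX, i₀, hi₀1, hi₀, hcol₀, fun j hj e => hmin j hj ⟨by omega, e⟩, hE, hNS⟩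

/-- ★★ **EXIT TURN OR END IN THE LEFTMOST COLUMN**: the LAST arc lying in the leftmost column `X` of a wound class-`B2a` walk either leaves
through `E` after a vertical entry — a turn `N → E` / `S → E` (possibly as the walk's last arc, re-entering `r` from the west) —, or it is
the walk's last arc leaving VERTICALLY onto a slanted side of `r`, which then lies in column `X`. [cite: GlazmanManolescu2019, §1, Fig. 1; Lemma 2.1]
[cite: CourantRobbins1958, Ch. V Appendix §2 (the even–odd rule)] -/
theorem left_exit_or_end (hh : holeFaceW w ∉ D) (hr : RootedFace D (w.side .W) r) (h : ω.IsB2a) {X : ℤ}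
    (hX : ∀ j < ω.2.arcs.length, X ≤ (ω.2.fc j).1) (hXw : X < w.1) {i : ℕ} (hi : i < ω.2.arcs.length)
    (hcol : (ω.2.fc i).1 = X) (hmax : ∀ j, i < j → j < ω.2.arcs.length → (ω.2.fc j).1 ≠ X) :
    (ω.2.sOut i = .E ∧ (ω.2.sIn i = .N ∨ ω.2.sIn i = .S)) ∨
      (i + 1 = ω.2.arcs.length ∧ (ω.1 = .N ∨ ω.1 = .S) ∧ r.1 = X ∧ (ω.2.sOut i = .N ∨ ω.2.sOut i = .S)) := by
  have hne' := forall_left_ne_W hh hr h hX hXw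
  obtain ⟨hWin, hWout⟩ := hne' i hi hcol
  have hsd := ω.2.sIn_ne_sOut hi
  by_cases hlast : i + 1 < ω.2.arcs.length
  · -- not the last arc: the successor lies in another column, so the exit is `E`
    have hnext := hmax (i + 1) (by omega) hlast
    have hE : ω.2.sOut i = .E := by
      cases hs : ω.2.sOut i
      · exact absurd hs hWout
      · rfl
      · exfalso; apply hnext; rw [ω.2.fc_succ_eq_of_sOut_S hlast hs]; exact hcol
      · exfalso; apply hnext; rw [ω.2.fc_succ_eq_of_sOut_N hlast hs]; exact hcol
    rw [hE] at hsd
    left; refine ⟨hE, ?_⟩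
    cases hs : ω.2.sIn i
    · exact absurd hs hWin
    · exact absurd hs hsd
    · exact Or.inr rfl
    · exact Or.inl rfl
  · have hlen1 : i + 1 = ω.2.arcs.length := by omega
    cases hs : ω.2.sOut i
    · exact absurd hs hWout
    · -- exit `E` as the last arc: still a turn (the entry is vertical)
      rw [hs] at hsd
      left; refine ⟨rfl, ?_⟩
      cases hs' : ω.2.sIn i
      · exact absurd hs' hWin
      · exact absurd hs' hsd
      · exact Or.inr rfl
      · exact Or.inl rfl
    · -- vertical end onto a slanted side of `r`
      right
      obtain ⟨-, hout⟩ := ω.2.side_sIn_eq_nth hi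
      rw [hlen1, ω.2.nth_length, hs] at hout
      rcases hfc : ω.2.fc i with ⟨x, y⟩
      rw [hfc] at hout hcol
      simp only at hcol
      have e : r.side ω.1 = .slant x y := by rw [← hout]; rfl
      rcases eq_of_side_eq_slant e with ⟨h2, hz⟩ | ⟨h2, hz⟩
      · exact ⟨hlen1, Or.inr hz, by rw [h2]; exact hcol, Or.inr rfl⟩
      · exact ⟨hlen1, Or.inl hz, by rw [h2]; exact hcol, Or.inr rfl⟩
    · right
      obtain ⟨-, hout⟩ := ω.2.side_sIn_eq_nth hi
      rw [hlen1, ω.2.nth_length, hs] at hout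
      rcases hfc : ω.2.fc i with ⟨x, y⟩
      rw [hfc] at hout hcol
      simp only at hcol
      have e : r.side ω.1 = .slant x (y + 1) := by rw [← hout]; rfl
      rcases eq_of_side_eq_slant e with ⟨h2, hz⟩ | ⟨h2, hz⟩
      · exact ⟨hlen1, Or.inr hz, by rw [h2]; exact hcol, Or.inl rfl⟩
      · exact ⟨hlen1, Or.inl hz, by rw [h2]; simpa using hcol, Or.inl rfl⟩

/-- ★★ **TWO ISOLATED TURNS IN THE LEFTMOST COLUMN (or one and a vertical end there).** The leftmost column `X ≤ w.1 − 2` of a wound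
class-`B2a` walk from the hole root carries two different `[corner]`/`[coCorner]` plaquettes — the entry turn of its first arc and the
exit turn of its last arc —, or one while the walk ends on a slanted side of an `r` lying in column `X`. (The column twin of
`two_top_turns`; the corner plaquettes of a rectangle are shared with the extreme rows.) [cite: GlazmanManolescu2019, §1, Fig. 1; Lemma 2.1]
[cite: CourantRobbins1958, Ch. V Appendix §2 (the even–odd rule)] -/
theorem two_left_turns (hh : holeFaceW w ∉ D) (hr : RootedFace D (w.side .W) r) (h : ω.IsB2a)
    (hA : ω.AJ hr h (toC (midPt (w.side .W))) ≠ 0) :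
    ∃ X : ℤ, X ≤ w.1 - 2 ∧ (∀ j < ω.2.arcs.length, X ≤ (ω.2.fc j).1) ∧ ∃ T : Finset Face,
      (∀ f ∈ T, f ∈ facesL ω.2.mids ∧ (kindsL ω.2.mids f = [.corner] ∨ kindsL ω.2.mids f = [.coCorner])) ∧
      (∀ f ∈ T, f.1 = X) ∧ (2 ≤ T.card ∨ (1 ≤ T.card ∧ (ω.1 = .N ∨ ω.1 = .S) ∧ r.1 = X)) := by
  classical
  obtain ⟨X, hXw, hX, i₀, hi₀1, hi₀, hcol₀, -, hE₀, hNS₀⟩ := exists_left_entry_turn hh hr h hA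
  have hsv : ∀ i, i < ω.2.arcs.length → (ω.2.fc i).1 = X → ∀ j < ω.2.arcs.length, ω.2.fc j = ω.2.fc i → j = i :=
    fun i hi hcol j hj he => (left_single_visit hh hr h hX (by omega) hi hj hcol he.symm).symm
  have hP₀ := isolated_turn hi₀ (hsv i₀ hi₀ hcol₀)
    (by rw [hE₀]; exact YBWalk.arcKind_ne_straight_of_WE_S (Or.inr rfl) (hNS₀.elim Or.inr Or.inl))
  -- the last index in column `X`
  have hex : ∃ n, ∃ i, i < ω.2.arcs.length ∧ (ω.2.fc i).1 = X ∧ n = ω.2.arcs.length - i := ⟨_, i₀, hi₀, hcol₀, rfl⟩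
  obtain ⟨i₁, hi₁, hcol₁, hn₁⟩ := Nat.find_spec hex
  have hmax : ∀ j, i₁ < j → j < ω.2.arcs.length → (ω.2.fc j).1 ≠ X := by
    intro j hj1 hj2 e
    have := Nat.find_min hex (m := ω.2.arcs.length - j) (by omega)
    exact this ⟨j, hj2, e, rfl⟩
  refine ⟨X, hXw, hX, ?_⟩
  rcases left_exit_or_end hh hr h hX (by omega) hi₁ hcol₁ hmax with ⟨hE₁, hNS₁⟩ | ⟨-, hz, hrX, -⟩
  · have hP₁ := isolated_turn hi₁ (hsv i₁ hi₁ hcol₁)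
      (by rw [hE₁]; exact YBWalk.arcKind_ne_straight_of_S_WE (hNS₁.elim Or.inr Or.inl) (Or.inr rfl))
    have hne : i₀ ≠ i₁ := by
      rintro rfl
      rcases hNS₁ with e | e <;> rw [hE₀] at e <;> exact absurd e (by decide)
    have hfne : ω.2.fc i₀ ≠ ω.2.fc i₁ := fun e => hne (hsv i₁ hi₁ hcol₁ i₀ hi₀ e)
    refine ⟨{ω.2.fc i₀, ω.2.fc i₁}, ?_, ?_, Or.inl (by rw [Finset.card_pair hfne])⟩
    · intro f hf
      rcases Finset.mem_insert.1 hf with rfl | hf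
      · exact hP₀
      · rw [Finset.mem_singleton.1 hf]; exact hP₁
    · intro f hf
      rcases Finset.mem_insert.1 hf with rfl | hf
      · exact hcol₀
      · rw [Finset.mem_singleton.1 hf]; exact hcol₁
  · exact ⟨{ω.2.fc i₀}, fun f hf => by rw [Finset.mem_singleton.1 hf]; exact hP₀,
      fun f hf => by rw [Finset.mem_singleton.1 hf]; exact hcol₀, Or.inr ⟨by simp, hz, hrX⟩⟩

end ΩG

end Literature.Probability.RandomPlanarGeometry.SAW.YangBaxter
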